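import Summits.AnomalousDissipation.AnomalousDissipation.Theorems.DopplerClockDopplerWorkIdentity
import Summits.AnomalousDissipation.AnomalousDissipation.Theorems.DopplerClockForceAdmissible
import Summits.AnomalousDissipation.AnomalousDissipation.Theorems.ImpulseGridGridThesisStubAcdcDesignIntegrals
import Literature.Analysis.FunctionSpaces.TorusSpaceTime
import Literature.Analysis.FunctionSpaces.TorusCalculusProofs
import Literature.Analysis.FunctionSpaces.TorusTestFunction

/-!
# Route DopplerClock (AnomalousDissipation) — support item `LaminarStreaks`
# (stmt-AnomalousDissipation-18132), part I: the streak array is an exact steady state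

For the swept Doppler pair `f = F sin(2πm x₁) cos(2πn x₂) e₀ = (F · Im e_M · Re e_N) e₀`
(`e_k = UnitAddTorus.mFourier k`, `M = m e₁`, `N = n e₂` in `ℤ³`), a drift `V` and a viscosity `ν`,
the field `u = V e₂ + sin(2πm x₁) [a cos(2πn x₂) + b sin(2πn x₂)] e₀` with zero pressure is a
classical steady solution of `NS_ν(f)` on `ℝ × T³` as soon as the amplitudes satisfy the two scalar
relations `2πnV b + ν(2π)²(m²+n²) a = F`, `2πnV a = ν(2π)²(m²+n²) b`
(`DopplerStreaks.isClassicalNSSolutionOn_streaks`; the item's `a = Fνκ²/D`, `b = FV(2πn)/D` solve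
them, see part II `DopplerClockLaminarStreaks`).

**Proof.** Write `Ψ_c = (Im e_M · Re e_N) e₀`, `Ψ_s = (Im e_M · Im e_N) e₀` and
`W = a Ψ_c + b Ψ_s`, so `u = V e₂ + W`. Both patterns are halves of sums of two Stokes modes at the
frequencies `M ± N` (product-to-sum), hence smooth, divergence free and `Δ`-eigenfields with
eigenvalue `4π²(m²+n²)`; `∂₀Ψ = 0` (no `x₀`-dependence), `∂₂Ψ_s = 2πn Ψ_c`, `∂₂Ψ_c = −2πn Ψ_s`
(`∂ⱼ e_k = 2πi kⱼ e_k`). Since `W ∥ e₀` and `∂₀W = 0`, `(u·∇)u = V ∂₂W`, and the momentum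
equation `V ∂₂W = νΔW + f` reduces to the two displayed relations (the `Ψ_c`- and
`Ψ_s`-components).

References: Foias–Manley–Rosa–Temam 2001, Ch. II §2 (2.6)–(2.9) (Stokes modes, Galilean drift);
Constantin–Foias 1988, Ch. 4 (4.13)–(4.14), (4.33) (Stokes eigenfields on the torus); Grafakos 2014,
Prop. 3.2.6 (derivatives of characters). No new definitions.
-/

noncomputable section

-- `Summit.<Summit>.<Problem>` is the tree's mandated summit-side namespace (CONVENTIONS §2); for this
-- single-conjunct summit the two coincide, so the duplicate is deliberate.
set_option linter.dupNamespace false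

open MeasureTheory Set Filter Topology UnitAddTorus
open scoped InnerProductSpace RealInnerProductSpace

namespace Summit.AnomalousDissipation.AnomalousDissipation.Theorems

open Literature.Analysis.FluidPDE Literature.Analysis.FluidPDE.Torus
open Literature.Analysis.FunctionSpaces Literature.Analysis.FunctionSpaces.Torus

namespace DopplerStreaks

/-- The flat three-torus (local notation). -/
local notation "𝕋³" => UnitAddTorus (Fin 3)
/-- Velocity values (local notation). -/
local notation "ℝ³" => EuclideanSpace ℝ (Fin 3)
/-- The streamwise unit vector `e₀` (local notation). -/
local notation "𝐞₀" => EuclideanSpace.single (0 : Fin 3) (1 : ℝ)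
/-- The drift direction `e₂` (local notation). -/
local notation "𝐞₂" => EuclideanSpace.single (2 : Fin 3) (1 : ℝ)
/-- The character `e_{m e₁}(x) = exp(2πi m x₁)` (local notation). -/
local notation:max "χ₁" m:max => UnitAddTorus.mFourier (Pi.single (1 : Fin 3) ((m : ℕ) : ℤ))
/-- The character `e_{n e₂}(x) = exp(2πi n x₂)` (local notation). -/
local notation:max "χ₂" n:max => UnitAddTorus.mFourier (Pi.single (2 : Fin 3) ((n : ℕ) : ℤ))

/-! ### Derivatives of characters and of the two patterns -/

/-- `∂ⱼ Re e_l = −2π lⱼ Im e_l` (from `∂ⱼ e_l = 2πi lⱼ e_l`, Grafakos 2014, Prop. 3.2.6). [folklore] -/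
theorem partialDeriv_re_mFourier (l : Fin 3 → ℤ) (j : Fin 3) (x : 𝕋³) :
    partialDeriv j (fun y => (mFourier l y).re) x =
      -(2 * Real.pi * (l j : ℝ) * (mFourier l x).im) := by
  have h := partialDeriv_clm_comp (isSmooth_mFourier l) Complex.reCLM j x
  rw [partialDeriv_mFourier] at h
  have e : (fun y => (mFourier l y).re) = (⇑Complex.reCLM ∘ ⇑(mFourier l)) := rfl
  rw [e, h]
  simp [Complex.mul_re, Complex.mul_im]

/-- **Partial derivatives of the conjugate pattern** `Ψ_c = (Im e_k · Re e_l) e₀`: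
`∂ⱼ Ψ_c = (2π kⱼ Re e_k Re e_l − 2π lⱼ Im e_k Im e_l) e₀` (Leibniz rule and
`∂ⱼ e_k = 2πi kⱼ e_k`). [folklore] -/
theorem partialDeriv_sinCos (k l : Fin 3 → ℤ) (j : Fin 3) (x : 𝕋³) :
    partialDeriv j (fun y : 𝕋³ => ((mFourier k y).im * (mFourier l y).re) • 𝐞₀) x =
      (2 * Real.pi * (k j : ℝ) * ((mFourier k x).re * (mFourier l x).re) -
        2 * Real.pi * (l j : ℝ) * ((mFourier k x).im * (mFourier l x).im)) • 𝐞₀ := by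
  have hk1 : IsContDiff 1 (fun y : 𝕋³ => (mFourier k y).im) :=
    (AcdcDesign.isSmooth_im_mFourier k).isContDiff (by simp)
  have hl1 : IsContDiff 1 (fun y : 𝕋³ => (mFourier l y).re) :=
    (AcdcDesign.isSmooth_re_mFourier l).isContDiff (by simp)
  have hprod : IsContDiff 1 (fun y : 𝕋³ => (mFourier k y).im * (mFourier l y).re) :=
    ContDiff.mul hk1 hl1
  have hconst : partialDeriv j (fun _ : 𝕋³ => 𝐞₀) x = 0 := by
    simp [Torus.partialDeriv, Torus.lineDeriv]
  rw [partialDeriv_smul hprod (isContDiff_const _), hconst, smul_zero, zero_add,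
    partialDeriv_mul hk1 hl1, AcdcDesign.partialDeriv_im_mFourier, partialDeriv_re_mFourier]
  congr 1
  ring

/-- **Partial derivatives of the streak pattern** `Ψ_s = (Im e_k · Im e_l) e₀`:
`∂ⱼ Ψ_s = (2π kⱼ Re e_k Im e_l + 2π lⱼ Im e_k Re e_l) e₀`. [folklore] -/
theorem partialDeriv_sinSin (k l : Fin 3 → ℤ) (j : Fin 3) (x : 𝕋³) :
    partialDeriv j (fun y : 𝕋³ => ((mFourier k y).im * (mFourier l y).im) • 𝐞₀) x =
      (2 * Real.pi * (k j : ℝ) * ((mFourier k x).re * (mFourier l x).im) +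
        2 * Real.pi * (l j : ℝ) * ((mFourier k x).im * (mFourier l x).re)) • 𝐞₀ := by
  have hk1 : IsContDiff 1 (fun y : 𝕋³ => (mFourier k y).im) :=
    (AcdcDesign.isSmooth_im_mFourier k).isContDiff (by simp)
  have hl1 : IsContDiff 1 (fun y : 𝕋³ => (mFourier l y).im) :=
    (AcdcDesign.isSmooth_im_mFourier l).isContDiff (by simp)
  have hprod : IsContDiff 1 (fun y : 𝕋³ => (mFourier k y).im * (mFourier l y).im) :=
    ContDiff.mul hk1 hl1
  have hconst : partialDeriv j (fun _ : 𝕋³ => 𝐞₀) x = 0 := by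
    simp [Torus.partialDeriv, Torus.lineDeriv]
  rw [partialDeriv_smul hprod (isContDiff_const _), hconst, smul_zero, zero_add,
    partialDeriv_mul hk1 hl1, AcdcDesign.partialDeriv_im_mFourier, AcdcDesign.partialDeriv_im_mFourier]
  congr 1
  ring

/-- `∂₀ Ψ_c = 0`: the conjugate pattern does not depend on `x₀`. [folklore] -/
theorem partialDeriv_zero_sinCos (m n : ℕ) (x : 𝕋³) :
    partialDeriv 0 (fun y : 𝕋³ => ((χ₁ m y).im * (χ₂ n y).re) • 𝐞₀) x = 0 := by
  rw [partialDeriv_sinCos]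
  simp

/-- `∂₀ Ψ_s = 0`: the streak pattern does not depend on `x₀`. [folklore] -/
theorem partialDeriv_zero_sinSin (m n : ℕ) (x : 𝕋³) :
    partialDeriv 0 (fun y : 𝕋³ => ((χ₁ m y).im * (χ₂ n y).im) • 𝐞₀) x = 0 := by
  rw [partialDeriv_sinSin]
  simp

/-- **The drift derivative of the conjugate pattern**: `∂₂ Ψ_c = −2πn Ψ_s`. [folklore] -/
theorem partialDeriv_two_sinCos (m n : ℕ) (x : 𝕋³) :
    partialDeriv 2 (fun y : 𝕋³ => ((χ₁ m y).im * (χ₂ n y).re) • 𝐞₀) x =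
      (-(2 * Real.pi * n * ((χ₁ m x).im * (χ₂ n x).im))) • 𝐞₀ := by
  rw [partialDeriv_sinCos]
  congr 1
  simp only [Pi.single_eq_same, Pi.single_eq_of_ne (show (2 : Fin 3) ≠ 1 by decide)]
  push_cast
  ring

/-! ### The conjugate pattern as a pair of Stokes modes -/

/-- `(Im e_k · Re e_l) a = ½ (stokesMode (k+l) a sin + stokesMode (k−l) a sin)`
(`sin · cos` product-to-sum at the level of characters). [folklore] -/
theorem sinCos_eq_stokesModes (k l : Fin 3 → ℤ) (a : ℝ³) :
    (fun y : 𝕋³ => ((mFourier k y).im * (mFourier l y).re) • a) =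
      fun x => (2⁻¹ : ℝ) • (stokesMode (k + l) a false x + stokesMode (k - l) a false x) := by
  funext x
  rw [im_mFourier_mul_re_mFourier, AcdcDesign.stokesMode_false_apply,
    AcdcDesign.stokesMode_false_apply, ← add_smul, smul_smul]
  congr 1
  ring

/-- **Regularity of the conjugate pattern**: `Ψ_c = sin(2πm x₁) cos(2πn x₂) e₀` is smooth,
divergence free and a `Δ`-eigenfield, `ΔΨ_c = −4π²(m²+n²) Ψ_c` (two sine Stokes modes at
`(0, m, ±n)` with the transversal amplitude `e₀`; Constantin–Foias 1988, Ch. 4, (4.13)–(4.14),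
(4.33)). [folklore] -/
theorem sinCos_regular (m n : ℕ) :
    IsSmooth (fun y : 𝕋³ => ((χ₁ m y).im * (χ₂ n y).re) • 𝐞₀) ∧
      IsDivFree (fun y : 𝕋³ => ((χ₁ m y).im * (χ₂ n y).re) • 𝐞₀) ∧
      ∀ x, laplacian (fun y : 𝕋³ => ((χ₁ m y).im * (χ₂ n y).re) • 𝐞₀) x =
        -((4 * Real.pi ^ 2 * ((m : ℝ) ^ 2 + (n : ℝ) ^ 2)) •
          (((χ₁ m x).im * (χ₂ n x).re) • 𝐞₀)) := by
  have e₁ : stokesEigenvalue (Pi.single (1 : Fin 3) (m : ℤ) + Pi.single (2 : Fin 3) (n : ℤ)) =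
      4 * Real.pi ^ 2 * ((m : ℝ) ^ 2 + (n : ℝ) ^ 2) := by
    rw [AcdcDesign.stokesEigenvalue_fin_three]
    simp
  have e₂ : stokesEigenvalue (Pi.single (1 : Fin 3) (m : ℤ) - Pi.single (2 : Fin 3) (n : ℤ)) =
      4 * Real.pi ^ 2 * ((m : ℝ) ^ 2 + (n : ℝ) ^ 2) := by
    rw [AcdcDesign.stokesEigenvalue_fin_three]
    simp
  have t₁ : ⟪latticeVec (Pi.single (1 : Fin 3) (m : ℤ) + Pi.single (2 : Fin 3) (n : ℤ)), 𝐞₀⟫ = 0 := by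
    rw [AcdcDesign.inner_latticeVec_fin_three]
    simp
  have t₂ : ⟪latticeVec (Pi.single (1 : Fin 3) (m : ℤ) - Pi.single (2 : Fin 3) (n : ℤ)), 𝐞₀⟫ = 0 := by
    rw [AcdcDesign.inner_latticeVec_fin_three]
    simp
  have hPat := sinCos_eq_stokesModes (Pi.single (1 : Fin 3) (m : ℤ)) (Pi.single (2 : Fin 3) (n : ℤ)) 𝐞₀
  rw [hPat]
  obtain ⟨hs, hΔ⟩ := AcdcDesign.eig_smul (AcdcDesign.eig_add
    (AcdcDesign.eig_mode 𝐞₀ false e₁) (AcdcDesign.eig_mode 𝐞₀ false e₂)) (2⁻¹ : ℝ)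
  refine ⟨hs, ?_, fun x => ?_⟩
  · exact AcdcDesign.isDivFree_const_smul'
      ((isSmooth_stokesMode _ _ false).add (isSmooth_stokesMode _ _ false))
      (AcdcDesign.isDivFree_add' (isSmooth_stokesMode _ _ false) (isSmooth_stokesMode _ _ false)
        (isDivFree_stokesMode t₁ false) (isDivFree_stokesMode t₂ false)) 2⁻¹
  · rw [hΔ x]
    have hx := congrFun hPat x
    rw [hx]

/-! ### The streak array is a steady classical solution -/

/-- **The steady drifted balance.** If the amplitudes `a`, `b` satisfy
`2πnV b + ν(2π)²(m²+n²) a = F` and `2πnV a = ν(2π)²(m²+n²) b`, then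
`u = V e₂ + sin(2πm x₁) [a cos(2πn x₂) + b sin(2πn x₂)] e₀` with zero pressure is a classical
solution of `NS_ν` forced by `F sin(2πm x₁) cos(2πn x₂) e₀` on all of `ℝ × T³`: the field is
steady, `(u·∇)u = V ∂₂W` (`W = u − V e₂ ∥ e₀`, `∂₀W = 0`), `ΔW = −(2π)²(m²+n²) W`, and the two
relations are the `sin·cos` / `sin·sin` components of `V ∂₂W = νΔW + f` (Foias–Manley–Rosa–Temam
2001, Ch. II (2.6)–(2.9)). [folklore] -/
theorem isClassicalNSSolutionOn_streaks (F V ν a b : ℝ) (m n : ℕ)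
    (h₁ : 2 * Real.pi * n * V * b + ν * ((2 * Real.pi) ^ 2 * ((m : ℝ) ^ 2 + (n : ℝ) ^ 2)) * a = F)
    (h₂ : 2 * Real.pi * n * V * a = ν * ((2 * Real.pi) ^ 2 * ((m : ℝ) ^ 2 + (n : ℝ) ^ 2)) * b) :
    IsClassicalNSSolutionOn univ ν
      (fun _ => fun x : 𝕋³ => (F * (χ₁ m x).im * (χ₂ n x).re) • 𝐞₀)
      (fun _ => fun x : 𝕋³ => V • 𝐞₂ + ((χ₁ m x).im * (a * (χ₂ n x).re + b * (χ₂ n x).im)) • 𝐞₀)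
      (fun _ _ => (0 : ℝ)) := by
  -- the two patterns and the fluctuation `W = a Ψ_c + b Ψ_s`
  obtain ⟨hc_s, hc_div, hc_Δ⟩ := sinCos_regular m n
  obtain ⟨hs_s, hs_div, hs_Δ⟩ := DopplerWork.pattern_regular m n
  have hc1 : IsContDiff 1 (fun y : 𝕋³ => ((χ₁ m y).im * (χ₂ n y).re) • 𝐞₀) :=
    hc_s.isContDiff (by simp)
  have hs1 : IsContDiff 1 (fun y : 𝕋³ => ((χ₁ m y).im * (χ₂ n y).im) • 𝐞₀) :=
    hs_s.isContDiff (by simp)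
  obtain ⟨W, hW⟩ : ∃ W : 𝕋³ → ℝ³, W = fun y =>
      a • (((χ₁ m y).im * (χ₂ n y).re) • 𝐞₀) + b • (((χ₁ m y).im * (χ₂ n y).im) • 𝐞₀) :=
    ⟨_, rfl⟩
  have hWreg : IsSmooth W ∧ ∀ x, laplacian W x =
      -((4 * Real.pi ^ 2 * ((m : ℝ) ^ 2 + (n : ℝ) ^ 2)) • W x) := by
    rw [hW]
    exact AcdcDesign.eig_add (AcdcDesign.eig_smul ⟨hc_s, hc_Δ⟩ a)
      (AcdcDesign.eig_smul ⟨hs_s, hs_Δ⟩ b)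
  have hWs : IsSmooth W := hWreg.1
  have hW1 : IsContDiff 1 W := hWs.isContDiff (by simp)
  have hWdiv : IsDivFree W := by
    rw [hW]
    exact AcdcDesign.isDivFree_add' (hc_s.smul a) (hs_s.smul b)
      (AcdcDesign.isDivFree_const_smul' hc_s hc_div a)
      (AcdcDesign.isDivFree_const_smul' hs_s hs_div b)
  -- partial derivatives and components of `W`
  have hdW : ∀ (i : Fin 3) (x : 𝕋³), partialDeriv i W x =
      a • partialDeriv i (fun y : 𝕋³ => ((χ₁ m y).im * (χ₂ n y).re) • 𝐞₀) x +
        b • partialDeriv i (fun y : 𝕋³ => ((χ₁ m y).im * (χ₂ n y).im) • 𝐞₀) x := by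
    intro i x
    have h := congrFun (partialDeriv_add (hc1.smul a) (hs1.smul b) i) x
    rw [partialDeriv_const_smul hc1, partialDeriv_const_smul hs1] at h
    rw [hW]
    exact h
  have hdW0 : ∀ x, partialDeriv 0 W x = 0 := fun x => by
    rw [hdW, partialDeriv_zero_sinCos, partialDeriv_zero_sinSin, smul_zero, smul_zero, add_zero]
  have hdW2 : ∀ x, partialDeriv 2 W x =
      a • ((-(2 * Real.pi * n * ((χ₁ m x).im * (χ₂ n x).im))) • 𝐞₀) +
        b • ((2 * Real.pi * n * ((χ₁ m x).im * (χ₂ n x).re)) • 𝐞₀) := fun x => by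
    rw [hdW, partialDeriv_two_sinCos, DopplerWork.partialDeriv_two_pattern]
  have hWapp1 : ∀ y, W y 1 = 0 := fun y => by
    rw [hW]
    simp
  have hWapp2 : ∀ y, W y 2 = 0 := fun y => by
    rw [hW]
    simp
  -- the velocity field is `V e₂ + W`
  have huL : (fun x : 𝕋³ =>
      V • 𝐞₂ + ((χ₁ m x).im * (a * (χ₂ n x).re + b * (χ₂ n x).im)) • 𝐞₀) =
      fun x => V • 𝐞₂ + W x := by
    funext x
    rw [hW]
    simp only [smul_smul, ← add_smul]
    congr 2
    ring
  have hUs : IsSmooth (fun x : 𝕋³ => V • 𝐞₂ + W x) := (isSmooth_const (V • 𝐞₂)).add hWs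
  have hU1 : IsContDiff 1 (fun x : 𝕋³ => V • 𝐞₂ + W x) := hUs.isContDiff (by simp)
  have hcdiv : IsDivFree (fun _ : 𝕋³ => V • 𝐞₂) := fun y => by
    simp [Torus.divergence, Torus.partialDeriv, Torus.lineDeriv]
  rw [huL]
  refine ⟨isSmoothSpaceTimeOn_const hUs univ,
    isSmoothSpaceTimeOn_const (isSmooth_const (0 : ℝ)) univ, fun t _ x => ?_, fun t _ => ?_⟩
  · -- the momentum equation at `(t, x)`: steady field
    have hdt : Torus.timeDerivWithin univ (fun _ : ℝ => fun y : 𝕋³ => V • 𝐞₂ + W y) t x = 0 := by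
      simp [Torus.timeDerivWithin]
    -- zero pressure
    have hgrad : Torus.gradient (fun _ : 𝕋³ => (0 : ℝ)) x = 0 := by
      rw [Torus.gradient, show liftAt (fun _ : 𝕋³ => (0 : ℝ)) x = (fun _ => 0) from rfl]
      exact gradient_fun_const 0 0
    -- the convective term is advection of `W` by the drift
    have hconv : convect (fun y : 𝕋³ => V • 𝐞₂ + W y) (fun y : 𝕋³ => V • 𝐞₂ + W y) x =
        V • partialDeriv 2 W x := by
      have hP : ∀ i, partialDeriv i (fun y : 𝕋³ => V • 𝐞₂ + W y) x = partialDeriv i W x := by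
        intro i
        have h := congrFun (partialDeriv_add (isContDiff_const (V • 𝐞₂)) hW1 i) x
        have hc : partialDeriv i (fun _ : 𝕋³ => V • 𝐞₂) x = 0 := by
          simp [Torus.partialDeriv, Torus.lineDeriv]
        rw [Pi.add_apply, hc, zero_add] at h
        exact h
      have h1 : (V • 𝐞₂ + W x) 1 = 0 := by simp [hWapp1]
      have h2 : (V • 𝐞₂ + W x) 2 = V := by simp [hWapp2]
      unfold Torus.convect
      rw [fderiv_apply_eq_sum_partialDeriv hU1, Fin.sum_univ_three, hP 0, hP 1, hP 2, hdW0,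
        smul_zero, zero_add, h1, zero_smul, zero_add, h2]
    -- the Laplacian of `V e₂ + W`
    have hlap : laplacian (fun y : 𝕋³ => V • 𝐞₂ + W y) x =
        -((4 * Real.pi ^ 2 * ((m : ℝ) ^ 2 + (n : ℝ) ^ 2)) • W x) := by
      have hΔc : Torus.laplacian (fun _ : 𝕋³ => V • 𝐞₂) x = 0 := by
        rw [Torus.laplacian, show liftAt (fun _ : 𝕋³ => V • 𝐞₂) x = (fun _ => V • 𝐞₂) from rfl,
          InnerProductSpace.laplacian_eq_iteratedFDeriv_stdOrthonormalBasis]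
        simp [iteratedFDeriv_const_of_ne]
      rw [AcdcDesign.laplacian_add_apply' (isSmooth_const (V • 𝐞₂)) hWs x, hΔc, zero_add,
        hWreg.2 x]
    rw [hdt, hconv, hlap, hgrad, sub_zero, zero_add, hdW2, hW]
    simp only [smul_smul, ← add_smul, ← neg_smul]
    congr 1
    linear_combination ((χ₁ m x).im * (χ₂ n x).re) * h₁ - ((χ₁ m x).im * (χ₂ n x).im) * h₂
  · -- incompressibility
    exact AcdcDesign.isDivFree_add' (isSmooth_const (V • 𝐞₂)) hWs hcdiv hWdiv

end DopplerStreaks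

end Summit.AnomalousDissipation.AnomalousDissipation.Theorems

end
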